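import Summits.NavierStokesRegularity.FunctionalMining.BiaxialEikonalObstruction
import Summits.NavierStokesRegularity.FunctionalMining.TopEigHeatCoerciveGap
import Summits.NavierStokesRegularity.FunctionalMining.TopEigRayleighSpectral
import Literature.Analysis.FunctionSpaces.TorusClassicalNSUniqueness
import HarnessLib

/-!
# FunctionalMining — the eikonal obstruction in EIGENVALUE form: a field (or a strain) independent of
# one coordinate has a zero strain eigenvalue somewhere; on `T³` it has a point with `λ₂ = 0`, so it is
# NOT top-biaxial everywhere (variable modulus included); Killing fields are constant

Search for candidate a priori estimates; no regularity claim. Cell `pub-nsfunc`, prove seat (gen 20).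
Static calculus of smooth fields on the flat torus; nothing about Navier–Stokes dynamics. Companion of
`BiaxialEikonalObstruction.lean` (SIEVELD §3.4b (4b)(ii)), restating its degeneracy principle in the
dictionary's eigenvalue vocabulary (`StrainEigen.lean`: sorted eigenvalues `torusStrainEig`, densities
`torusStrainTopEig = λ₁`, `torusStrainMidEig = λ₂`, `torusStrainBotEig = λ₃`; `TopEigHeatCoerciveGap.lean`:
top-gap classes `λ₂ ≤ (1 − η)λ₁`).

* `det_torusStrainMatrix_eq_prod`: `det S(x) = ∏ₖ λₖ(x)`.
* `exists_torusStrainEig_eq_zero` (`_of_strain_invariant`): if `∂ₖv ≡ 0` — or only the strain matrix is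
  invariant under `x ↦ x + t eₖ` — some sorted strain eigenvalue vanishes at some point (the `k`-th strain
  column vanishes at an extremum of `v_k`).
* `exists_midEig_eq_zero` (`_of_strain_invariant`), `card d = 3`, divergence free: there is a point with
  **`λ₂ = 0` and `λ₃ = −λ₁`** (a sorted zero-sum triple containing `0` has middle entry `0`); hence
  `not_forall_topBiaxial` (`_of_strain_invariant`): **no such field is top-biaxial `λ₁ = λ₂ > 0` at every
  point** — (4b)(ii) with VARIABLE modulus `m(x) > 0`, in eigenvalue form —, `not_forall_botBiaxial`, and
  `exists_gap_point`: the field has a point inside every top-gap class `λ₂ ≤ (1 − η)λ₁`, `η ≤ 1` (it is never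
  uniformly near-biaxial). Bearing on SIEVELD §3.4b (4h) ("for variable `m(x)` no non-trivial periodic
  div-free example known"): among fields whose strain is independent of one coordinate there is none.
* `killing_const`, `const_of_torusStrainMatrix_eq_zero`, `sub_const_of_torusStrainMatrix_eq` [folklore]:
  Killing fields of the flat torus are constant; **the strain matrix determines a smooth field on the torus
  up to an additive constant** (`torusStrainMatrix_sub`: the strain is additive).
NOT here: fully three-dimensional axis fields (§3.4b (4d)); anything about L-λ minimising sequences; no
verdict change. [ours = assembly; folklore = linear algebra / Killing]
-/

noncomputable section

namespace Summit.NavierStokesRegularity.FunctionalMining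
open Literature.Analysis Literature.Analysis.FunctionSpaces Literature.Analysis.FunctionSpaces.Torus
  Literature.Analysis.FluidPDE MeasureTheory Set

namespace BiaxialEikonal

variable {d : Type*} [Fintype d] [DecidableEq d]

/-! ## 5. Spectral reading: a zero strain eigenvalue somewhere; at `card d = 3`, a point with `λ₂ = 0` -/

/-- `det S(x) = ∏ₖ λₖ(x)` over the sorted strain eigenvalues (Mathlib `IsHermitian.det_eq_prod_eigenvalues`,
re-indexed from `d` to `Fin (card d)`). [folklore] -/
theorem det_torusStrainMatrix_eq_prod (v : UnitAddTorus d → EuclideanSpace ℝ d) (x : UnitAddTorus d) :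
    (torusStrainMatrix v x).det = ∏ k, torusStrainEig v x k := by
  rw [(torusStrainMatrix_isHermitian v x).det_eq_prod_eigenvalues]
  simp only [RCLike.ofReal_real_eq_id, id]
  exact Fintype.prod_equiv (Fintype.equivOfCardEq (Fintype.card_fin _)).symm _ _ (fun i => rfl)

/-- **A field independent of one coordinate has a ZERO STRAIN EIGENVALUE somewhere**: if `∂ₖv ≡ 0` then
at an extremum `p` of `v_k` the strain annihilates `eₖ` (`exists_strain_col_eq_zero`), so `det S(p) = 0` and
one of the sorted eigenvalues `λₖ(p)` vanishes. [ours] -/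
theorem exists_torusStrainEig_eq_zero {v : UnitAddTorus d → EuclideanSpace ℝ d} (hv : Torus.IsSmooth v)
    {k : d} (hk : ∀ x, Torus.partialDeriv k v x = 0) :
    ∃ p, ∃ i, torusStrainEig v p i = 0 := by
  obtain ⟨p, hp⟩ := exists_strain_col_eq_zero hv hk
  have hdet : (torusStrainMatrix v p).det = 0 := Matrix.det_eq_zero_of_column_eq_zero k hp
  rw [det_torusStrainMatrix_eq_prod] at hdet
  obtain ⟨i, -, hi⟩ := Finset.prod_eq_zero_iff.mp hdet
  exact ⟨p, i, hi⟩

/-- The same when only the STRAIN is independent of the coordinate `xₖ`. [ours] -/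
theorem exists_torusStrainEig_eq_zero_of_strain_invariant {v : UnitAddTorus d → EuclideanSpace ℝ d}
    (hv : Torus.IsSmooth v) (k : d)
    (hS : ∀ (x : UnitAddTorus d) (t : ℝ), torusStrainMatrix v (x + proj (t • EuclideanSpace.single k (1 : ℝ)))
      = torusStrainMatrix v x) :
    ∃ p, ∃ i, torusStrainEig v p i = 0 :=
  exists_torusStrainEig_eq_zero hv (partialDeriv_eq_zero_of_strain_invariant hv k hS)

/-- Three reals sorted decreasingly with zero sum, one of which vanishes, have vanishing middle one.
[folklore] -/
theorem sorted_three_middle_eq_zero {f : Fin 3 → ℝ} (hf : Antitone f) (hsum : f 0 + f 1 + f 2 = 0)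
    {i : Fin 3} (hi : f i = 0) : f 1 = 0 := by
  have h01 : f 1 ≤ f 0 := hf (by decide)
  have h12 : f 2 ≤ f 1 := hf (by decide)
  fin_cases i
  · change f 0 = 0 at hi; linarith
  · exact hi
  · change f 2 = 0 at hi; linarith

/-- **At `card d = 3`: a smooth divergence-free field independent of one coordinate has a point where
`λ₂ = 0` and `λ₃ = −λ₁`** (the strain there is a trace-free plane shear `λ, 0, −λ`, the top gap
`(λ₁ − λ₂)/λ₁` is maximal). In the dictionary's vocabulary (`StrainEigen.lean`):
`torusStrainMidEig v p = 0`, `torusStrainBotEig v p = −torusStrainTopEig v p`. [ours] -/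
theorem exists_midEig_eq_zero (hd : Fintype.card d = 3) {v : UnitAddTorus d → EuclideanSpace ℝ d}
    (hv : Torus.IsSmooth v) (hdiv : Torus.IsDivFree v) {k : d} (hk : ∀ x, Torus.partialDeriv k v x = 0) :
    ∃ p, torusStrainMidEig v p = 0 ∧ torusStrainBotEig v p = -torusStrainTopEig v p := by
  obtain ⟨p, i, hi⟩ := exists_torusStrainEig_eq_zero hv hk
  set e := torusStrainEig v p with he
  set f : Fin 3 → ℝ := fun j => e (Fin.cast hd.symm j) with hfdef
  have hf : Antitone f := fun a b hab =>
    torusStrainEig_antitone v p (show Fin.cast hd.symm a ≤ Fin.cast hd.symm b by simpa using hab)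
  have hsume : ∑ j, f j = ∑ k', e k' :=
    Fintype.sum_equiv (finCongr hd.symm) f e (fun j => rfl)
  have hsum3 : f 0 + f 1 + f 2 = 0 := by
    rw [← Fin.sum_univ_three, hsume, he, sum_torusStrainEig_eq_zero hv hdiv p]
  have hfi : f (Fin.cast hd i) = 0 := by
    have hc : Fin.cast hd.symm (Fin.cast hd i) = i := Fin.ext rfl
    simp only [hfdef, hc]
    exact hi
  have hmid : f 1 = 0 := sorted_three_middle_eq_zero hf hsum3 hfi
  have htop : torusStrainTopEig v p = f 0 := by
    unfold torusStrainTopEig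
    rw [← he, ← (finCongr hd.symm).iSup_comp]
    change (⨆ j, f j) = f 0
    exact TopEig.iSup_eq_apply_zero_of_antitone (by norm_num) hf
  have hbot : torusStrainBotEig v p = f 2 := by
    unfold torusStrainBotEig
    rw [← he, ← (finCongr hd.symm).iInf_comp]
    change (⨅ j, f j) = f 2
    exact le_antisymm (ciInf_le (Set.finite_range f).bddBelow 2) (le_ciInf fun j => hf (Fin.le_last j))
  refine ⟨p, ?_, ?_⟩
  · unfold torusStrainMidEig
    rw [← he, sum_torusStrainEig_eq_zero hv hdiv p, htop, hbot]
    linarith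
  · rw [htop, hbot]
    linarith

/-- The same when only the strain is independent of `xₖ`. [ours] -/
theorem exists_midEig_eq_zero_of_strain_invariant (hd : Fintype.card d = 3)
    {v : UnitAddTorus d → EuclideanSpace ℝ d} (hv : Torus.IsSmooth v) (hdiv : Torus.IsDivFree v) (k : d)
    (hS : ∀ (x : UnitAddTorus d) (t : ℝ), torusStrainMatrix v (x + proj (t • EuclideanSpace.single k (1 : ℝ)))
      = torusStrainMatrix v x) :
    ∃ p, torusStrainMidEig v p = 0 ∧ torusStrainBotEig v p = -torusStrainTopEig v p :=
  exists_midEig_eq_zero hd hv hdiv (partialDeriv_eq_zero_of_strain_invariant hv k hS)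

/-- **NO 2.5-D FIELD IS TOP-BIAXIAL EVERYWHERE** (dictionary vocabulary; the eigenvalue form of
`no_biaxial_strain_of_partialDeriv_eq_zero`, variable modulus included): for a smooth divergence-free `v`
on `T³` with `∂ₖv ≡ 0` it is impossible that `λ₂(x) = λ₁(x) > 0` at every point. [ours] -/
theorem not_forall_topBiaxial (hd : Fintype.card d = 3) {v : UnitAddTorus d → EuclideanSpace ℝ d}
    (hv : Torus.IsSmooth v) (hdiv : Torus.IsDivFree v) {k : d} (hk : ∀ x, Torus.partialDeriv k v x = 0) :
    ¬ ∀ x, torusStrainMidEig v x = torusStrainTopEig v x ∧ 0 < torusStrainTopEig v x := by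
  intro h
  obtain ⟨p, hmid, -⟩ := exists_midEig_eq_zero hd hv hdiv hk
  have := h p
  linarith [this.1, this.2]

/-- … nor BOTTOM-BIAXIAL everywhere (`λ₂(x) = λ₃(x) < 0` at every point). [ours] -/
theorem not_forall_botBiaxial (hd : Fintype.card d = 3) {v : UnitAddTorus d → EuclideanSpace ℝ d}
    (hv : Torus.IsSmooth v) (hdiv : Torus.IsDivFree v) {k : d} (hk : ∀ x, Torus.partialDeriv k v x = 0) :
    ¬ ∀ x, torusStrainMidEig v x = torusStrainBotEig v x ∧ torusStrainBotEig v x < 0 := by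
  intro h
  obtain ⟨p, hmid, -⟩ := exists_midEig_eq_zero hd hv hdiv hk
  have := h p
  linarith [this.1, this.2]

/-- Strain-invariant form of `not_forall_topBiaxial`: a smooth divergence-free field on `T³` whose STRAIN
is independent of one coordinate is not top-biaxial everywhere — (4b)(ii) for variable modulus `m(x) > 0`
in eigenvalue form. [ours] -/
theorem not_forall_topBiaxial_of_strain_invariant (hd : Fintype.card d = 3)
    {v : UnitAddTorus d → EuclideanSpace ℝ d} (hv : Torus.IsSmooth v) (hdiv : Torus.IsDivFree v) (k : d)
    (hS : ∀ (x : UnitAddTorus d) (t : ℝ), torusStrainMatrix v (x + proj (t • EuclideanSpace.single k (1 : ℝ)))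
      = torusStrainMatrix v x) :
    ¬ ∀ x, torusStrainMidEig v x = torusStrainTopEig v x ∧ 0 < torusStrainTopEig v x :=
  not_forall_topBiaxial hd hv hdiv (partialDeriv_eq_zero_of_strain_invariant hv k hS)

/-- Gap-class reading (`TopEigHeatCoerciveGap.StrainGapClass`): such a field has a point lying in EVERY
top-gap class `λ₂ ≤ (1 − η)λ₁`, `η ≤ 1` — it cannot be uniformly near-biaxial. [ours] -/
theorem exists_gap_point (hd : Fintype.card d = 3) {v : UnitAddTorus d → EuclideanSpace ℝ d}
    (hv : Torus.IsSmooth v) (hdiv : Torus.IsDivFree v) {k : d} (hk : ∀ x, Torus.partialDeriv k v x = 0) :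
    ∃ p, ∀ η : ℝ, η ≤ 1 → torusStrainMidEig v p ≤ (1 - η) * torusStrainTopEig v p := by
  obtain ⟨p, hmid, -⟩ := exists_midEig_eq_zero hd hv hdiv hk
  refine ⟨p, fun η hη => ?_⟩
  rw [hmid]
  exact mul_nonneg (by linarith) (torusStrainTopEig_nonneg hd hv hdiv p)

/-! ## 6. Killing fields are constant; the strain determines the field up to a constant -/

/-- **Every Killing field of the flat torus is constant**: `sym ∇w ≡ 0 ⇒ w(x) = w(y)`. [folklore] -/
theorem killing_const {w : UnitAddTorus d → EuclideanSpace ℝ d} (hw : Torus.IsSmooth w)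
    (hK : ∀ x i j, Torus.partialDeriv j w x i + Torus.partialDeriv i w x j = 0) (x y : UnitAddTorus d) :
    w x = w y :=
  eq_of_forall_partialDeriv_eq_zero (hw.isContDiff (by simp)) (fun j z => killing_parallel hw hK j z) x y

/-- In strain-matrix form: `torusStrainMatrix w ≡ 0 ⇒ w` constant. [folklore] -/
theorem const_of_torusStrainMatrix_eq_zero {w : UnitAddTorus d → EuclideanSpace ℝ d}
    (hw : Torus.IsSmooth w) (hS : ∀ x, torusStrainMatrix w x = 0) (x y : UnitAddTorus d) : w x = w y := by
  refine killing_const hw (fun z i j => ?_) x y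
  have h := congrFun (congrFun (hS z) i) j
  rw [torusStrainMatrix_apply, Matrix.zero_apply] at h
  linarith

/-- The strain matrix is additive in the field (for `C¹` fields). [folklore] -/
theorem torusStrainMatrix_sub {v₁ v₂ : UnitAddTorus d → EuclideanSpace ℝ d} (h₁ : Torus.IsSmooth v₁)
    (h₂ : Torus.IsSmooth v₂) (x : UnitAddTorus d) :
    torusStrainMatrix (v₁ - v₂) x = torusStrainMatrix v₁ x - torusStrainMatrix v₂ x := by
  ext i j
  rw [Matrix.sub_apply, torusStrainMatrix_apply, torusStrainMatrix_apply, torusStrainMatrix_apply,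
    partialDeriv_sub (h₁.isContDiff (by simp)) (h₂.isContDiff (by simp)),
    partialDeriv_sub (h₁.isContDiff (by simp)) (h₂.isContDiff (by simp))]
  simp only [Pi.sub_apply, PiLp.sub_apply]
  ring

/-- **THE STRAIN DETERMINES THE FIELD UP TO AN ADDITIVE CONSTANT** on the torus: two smooth fields with
the same strain matrix everywhere differ by a constant vector (their difference is a Killing field).
So every pointwise structure imposed on `S` — biaxiality, eigenvalue constraints — is a constraint on `v`
itself modulo constants. [folklore] -/
theorem sub_const_of_torusStrainMatrix_eq {v₁ v₂ : UnitAddTorus d → EuclideanSpace ℝ d}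
    (h₁ : Torus.IsSmooth v₁) (h₂ : Torus.IsSmooth v₂) (hS : ∀ x, torusStrainMatrix v₁ x = torusStrainMatrix v₂ x)
    (x y : UnitAddTorus d) : v₁ x - v₂ x = v₁ y - v₂ y := by
  have h := const_of_torusStrainMatrix_eq_zero (h₁.sub h₂) (fun z => by rw [torusStrainMatrix_sub h₁ h₂, hS z, sub_self]) x y
  simpa only [Pi.sub_apply] using h

end BiaxialEikonal

end Summit.NavierStokesRegularity.FunctionalMining

end
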